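import Mathlib
import Summits.QuantumFields.YangMills.Theorems.TransportFieldFanoWeightedPlaquette
import Summits.QuantumFields.YangMills.Theorems.TransportFieldFanoVacuumEnergyBudget
import Summits.QuantumFields.YangMills.Theorems.FemtoTransferGapTranslationOnePoint
import HarnessLib

/-!
# The registered stub `stub_dWeightedPlaquetteMean` of ⟨stmt-QuantumFields-23362⟩ FOLLOWS from an exponentially weak torelon floor
# `log(1/E_Ω[F]) ≤ C_ε β^ε L^k` (route `TransportFieldFano`, LINE g17-A; helper lane)

Sequel to ✓`…TransportFieldFanoWeightedPlaquette` (★★★ `weighted_link_plaquette_le_log`: the weighted temporal plaquette of the vacuum, for every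
physical weight `0 ≤ w ≤ W` and `Ω ≥ 0`, up to `½log(1/E[wΩ²])`).
* §1 ★★ `weighted_link_plaquette_symm_le_log` — the STUB'S SHAPE: symmetrised weight `w(U) + w(V)`, every `l2`-normalised physical
  eigenfunction `Ω` of any sign (`Ω = aΩ₊` pointwise, ✓`PolyakovLift.rawVacuum_eq_smul_of_gap`), kernel symmetry and `Re tr W⁻¹ = Re tr W`:
  `∫∫ Ω(U)K_β(U,V)Ω(V)(w(U)+w(V))(4 − 2Re tr U_ℓV_ℓ⁻¹) ≤ (8/β)·λ₀·E[wΩ²]·(6 + ½log W − log uniformFloorConst L + ½log(1/E[wΩ²]))`;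
* §2 ★★★ `dWeightedPlaquetteMean_of_logFloor` — with `w = d_x = 4 − (Re tr P₀(x))²` (`W = 4`, ✓`AdjointLoopFano.isPhys_adjLoopAt`) and the
  translation invariance `E[d_xΩ²] = E[FΩ²]` (✓`l2_flowLiftAt_mul_vacuum_eq_flowLift`, `F` = site average): the registered stub text
  `DWeightedPlaquetteMeanP` (verbatim) holds as soon as, eventually in `β`, `0 < E[FΩ²]` and `log(1/E[FΩ²]) ≤ C₀·β^ε·L^{k₀}` for every `ε > 0`
  (`k = k₀ + 4`, `C = 1088 + 4C₀`, `−log c_L ≤ 129L⁴` from ✓`neg_log_uniformFloorConst_le_pow`).  The torelon floor the stub needs is thus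
  `E_Ω[4 − (Re tr P_x)²] ≥ exp(−C₀ β^ε L^{k₀})` — EXPONENTIALLY weak (the polynomial floor of ✓`dWeightedPlaquetteMean_of_torelonMeanFloor` is
  superseded); the Harnack comparison of the planner's memo is not needed at all.

HONEST FRAMING: fixed-lattice helper estimates and a conditional reduction (`--supports 23362`); the residual floor, the stub, the crux, K2a and
every rung / summit statement remain OPEN; nothing about infinite volume, the continuum or the Yang–Mills mass gap.  No `sorry`, no new definition.
References: [cite: ReedSimonIV1978, Thm. XIII.43]; [cite: Luscher1983, §2–3].
-/

set_option autoImplicit false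

noncomputable section

open MeasureTheory Filter Topology Real
open Literature.MathematicalPhysics.QuantumFieldTheory (GaugeConfig Site Edge Plaquette gaugeTransform wilsonAction)
open Literature.MathematicalPhysics.QuantumLattice (fundamentalRep_apply secondCountableTopology_su2)

namespace Summit.QuantumFields.YangMills.Theorems.TransportFieldFano

open Summit.QuantumFields.YangMills.Theorems.FemtoTransferGap
open Summit.QuantumFields.YangMills.Theorems.AdjointLoopFano

variable {L : ℕ} [NeZero L]

/-! ## §1 The symmetrised, sign-free form -/

/-- ★★ **Weighted temporal plaquette, stub shape** (`β ≥ 1`; every `l2`-normalised physical `Ω` with `K_βΩ = λ₀Ω`; a measurable weight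
`0 ≤ w ≤ W` with `wΩ` physical and `E[wΩ²] > 0`; any link `ℓ`):
`∫∫ Ω(U)K_β(U,V)Ω(V)·(w(U)+w(V))·(4 − 2Re tr U_ℓV_ℓ⁻¹) ≤ (8/β)·λ₀·E[wΩ²]·(6 + ½log W − log uniformFloorConst L + ½ log(1/E[wΩ²]))`.
[cite: Luscher1983, §2–3] [cite: ReedSimonIV1978, Thm. XIII.43] -/
theorem weighted_link_plaquette_symm_le_log {β : ℝ} (hβ : 1 ≤ β) {Ω : GaugeConfig 3 L SU2 → ℝ} (hΩ : IsPhys Ω)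
    (hn : l2 Ω Ω = 1) (heig : transferApply β Ω = topValue su2Rep L β • Ω)
    {w : GaugeConfig 3 L SU2 → ℝ} (hwΩ : IsPhys fun U => w U * Ω U) (hwm : Measurable w) {W : ℝ} (hw0 : ∀ U, 0 ≤ w U)
    (hwW : ∀ U, w U ≤ W) (hpos : 0 < ∫ U, w U * Ω U ^ 2 ∂configMeasure SU2 L) (ℓ : Edge 3 L) :
    ∫ p, Ω p.1 * transferKernel su2Rep β p.1 p.2 * Ω p.2 *
        ((w p.1 + w p.2) * (4 - 2 * ((((p.1 ℓ * (p.2 ℓ)⁻¹ : SU2) : Matrix (Fin 2) (Fin 2) ℂ)).trace).re))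
        ∂(configMeasure SU2 L).prod (configMeasure SU2 L) ≤
      (8 / β) * topValue su2Rep L β * (∫ U, w U * Ω U ^ 2 ∂configMeasure SU2 L) *
        (6 + Real.log W / 2 - Real.log (uniformFloorConst L) + Real.log ((∫ U, w U * Ω U ^ 2 ∂configMeasure SU2 L)⁻¹) / 2) := by
  haveI : SecondCountableTopology SU2 := secondCountableTopology_su2
  have hβ0 : 0 < β := by linarith
  set μ2 : Measure (GaugeConfig 3 L SU2 × GaugeConfig 3 L SU2) := (configMeasure SU2 L).prod (configMeasure SU2 L) with hμ2
  -- Perron–Frobenius: `Ω = a Ω₊` pointwise, `Ω'' = |a| Ω₊ ≥ 0` has the same pair weight and the same `E[wΩ²]`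
  obtain ⟨Ωp, θ, cp, hΩp, hcp, hΩpge, hnp, heigp, -, hθ, hgap⟩ := PhysL2.exists_groundState (L := L) β
  have hφΩ := PolyakovLift.rawVacuum_eq_smul_of_gap β hΩ heig hΩp hnp heigp hθ hgap
  set a : ℝ := l2 Ω Ωp with ha
  set σ : ℝ := if 0 ≤ a then 1 else -1 with hσ
  have hσa : σ * |a| = a := by
    rw [hσ]; split_ifs with h
    · rw [abs_of_nonneg h, one_mul]
    · rw [abs_of_neg (not_le.mp h)]; ring
  have hσ2 : σ * σ = 1 := by rw [hσ]; split_ifs <;> norm_num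
  set Ω'' : GaugeConfig 3 L SU2 → ℝ := fun U => |a| * Ωp U with hΩ''_def
  have hΩΩ'' : ∀ U, Ω U = σ * Ω'' U := fun U => by rw [hφΩ U, hΩ''_def]; dsimp only; rw [← mul_assoc, hσa]
  have hΩ'' : IsPhys Ω'' := by
    have h := hΩp.smul |a|
    have e' : (|a| • Ωp) = Ω'' := by funext U; simp [hΩ''_def]
    rw [← e']; exact h
  have hΩ''nn : ∀ U, 0 ≤ Ω'' U := fun U => mul_nonneg (abs_nonneg a) (hcp.le.trans (hΩpge U))
  have heig'' : transferApply β Ω'' = topValue su2Rep L β • Ω'' := by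
    have e' : Ω'' = |a| • Ωp := by funext U; simp [hΩ''_def]
    rw [e', transferApply_smul, heigp, smul_smul, smul_smul, mul_comm]
  have hsq : ∀ U, Ω U ^ 2 = Ω'' U ^ 2 := fun U => by
    rw [hΩΩ'' U, mul_pow, show σ ^ 2 = 1 by rw [sq, hσ2], one_mul]
  have hn'' : l2 Ω'' Ω'' = 1 := by
    rw [← hn]; unfold l2; refine integral_congr_ae (ae_of_all _ fun U => ?_)
    have h1 : Ω'' U * Ω'' U = Ω'' U ^ 2 := by ring
    have h2 : Ω U * Ω U = Ω U ^ 2 := by ring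
    dsimp only
    rw [h1, h2, hsq]
  have hwΩ'' : IsPhys fun U => w U * Ω'' U := by
    have e' : (fun U => w U * Ω'' U) = σ • fun U => w U * Ω U := by
      funext U; simp only [Pi.smul_apply, smul_eq_mul]; rw [hΩΩ'' U]
      have : σ * (w U * (σ * Ω'' U)) = σ * σ * (w U * Ω'' U) := by ring
      rw [this, hσ2, one_mul]
    rw [e']; exact hwΩ.smul σ
  have hm'' : ∫ U, w U * Ω'' U ^ 2 ∂configMeasure SU2 L = ∫ U, w U * Ω U ^ 2 ∂configMeasure SU2 L :=
    integral_congr_ae (ae_of_all _ fun U => by dsimp only; rw [hsq])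
  -- the core bound for `Ω''` (one-sided weight)
  have hcore := weighted_link_plaquette_le_log hβ hΩ'' hΩ''nn hn'' heig'' hwΩ'' hwm hw0 hwW (by rw [hm'']; exact hpos) ℓ
  rw [hm''] at hcore
  -- the `w(V)` half equals the `w(U)` half (swap `U ↔ V`: kernel symmetric, `Re tr W⁻¹ = Re tr W`)
  set q : GaugeConfig 3 L SU2 × GaugeConfig 3 L SU2 → ℝ :=
    fun p => 2 - ((((p.1 ℓ * (p.2 ℓ)⁻¹ : SU2) : Matrix (Fin 2) (Fin 2) ℂ)).trace).re with hq_def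
  have hqsymm : ∀ U V : GaugeConfig 3 L SU2, q (V, U) = q (U, V) := fun U V => by
    rw [hq_def]; dsimp only
    have : (V ℓ * (U ℓ)⁻¹ : SU2) = (U ℓ * (V ℓ)⁻¹)⁻¹ := by rw [mul_inv_rev, inv_inv]
    rw [this, re_trace_inv]
  have hswap : ∫ p, w p.2 * (Ω'' p.1 * transferKernel su2Rep β p.1 p.2 * Ω'' p.2) * q p ∂μ2 =
      ∫ p, w p.1 * (Ω'' p.1 * transferKernel su2Rep β p.1 p.2 * Ω'' p.2) * q p ∂μ2 := by
    rw [hμ2, ← integral_prod_swap]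
    refine integral_congr_ae (ae_of_all _ fun p => ?_)
    simp only [Prod.fst_swap, Prod.snd_swap]
    rw [transferKernel_su2Rep_symm β p.2 p.1, show q p.swap = q p from by
      rw [show p.swap = (p.2, p.1) from rfl, hqsymm p.1 p.2]]
    ring
  -- rewrite the goal on `Ω''` and split
  have hgoal : (fun p : GaugeConfig 3 L SU2 × GaugeConfig 3 L SU2 => Ω p.1 * transferKernel su2Rep β p.1 p.2 * Ω p.2 *
      ((w p.1 + w p.2) * (4 - 2 * ((((p.1 ℓ * (p.2 ℓ)⁻¹ : SU2) : Matrix (Fin 2) (Fin 2) ℂ)).trace).re))) =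
      fun p => 2 * (w p.1 * (Ω'' p.1 * transferKernel su2Rep β p.1 p.2 * Ω'' p.2) * q p) +
        2 * (w p.2 * (Ω'' p.1 * transferKernel su2Rep β p.1 p.2 * Ω'' p.2) * q p) := by
    funext p
    rw [hΩΩ'' p.1, hΩΩ'' p.2, hq_def]; dsimp only
    have : σ * Ω'' p.1 * transferKernel su2Rep β p.1 p.2 * (σ * Ω'' p.2) = σ * σ * (Ω'' p.1 * transferKernel su2Rep β p.1 p.2 * Ω'' p.2) := by
      ring
    rw [this, hσ2, one_mul]; ring
  -- integrability of the two halves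
  obtain ⟨CΩ, hCΩ⟩ := hΩ''.bounded
  have hCΩ0 : 0 ≤ CΩ := (abs_nonneg _).trans (hCΩ (fun _ => 1))
  have hW0 : 0 < W := by
    by_contra hW; push Not at hW
    have : ∫ U, w U * Ω U ^ 2 ∂configMeasure SU2 L ≤ 0 :=
      integral_nonpos fun U => mul_nonpos_of_nonpos_of_nonneg (by linarith [hw0 U, hwW U]) (sq_nonneg _)
    linarith
  have hwb : ∀ U, |w U| ≤ W := fun U => by rw [abs_of_nonneg (hw0 U)]; exact hwW U
  have hq0 : ∀ p, 0 ≤ q p := fun p => by rw [hq_def]; dsimp only; linarith [re_trace_le_two (p.1 ℓ * (p.2 ℓ)⁻¹)]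
  have hq4 : ∀ p, q p ≤ 4 := fun p => by rw [hq_def]; dsimp only; linarith [neg_two_le_re_trace (p.1 ℓ * (p.2 ℓ)⁻¹)]
  have hqm : Measurable q := by
    have hc : Continuous fun p : GaugeConfig 3 L SU2 × GaugeConfig 3 L SU2 => (p.1 ℓ * (p.2 ℓ)⁻¹ : SU2) :=
      ((continuous_apply ℓ).comp continuous_fst).mul ((continuous_apply ℓ).comp continuous_snd).inv
    exact (continuous_const.sub (Complex.continuous_re.comp ((continuous_subtype_val.comp hc).matrix_trace))).measurable
  have hKm : Measurable fun p : GaugeConfig 3 L SU2 × GaugeConfig 3 L SU2 => transferKernel su2Rep β p.1 p.2 :=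
    measurable_transferKernel_lat β
  have hpwm : Measurable fun p : GaugeConfig 3 L SU2 × GaugeConfig 3 L SU2 => Ω'' p.1 * transferKernel su2Rep β p.1 p.2 * Ω'' p.2 :=
    ((hΩ''.measurable.comp measurable_fst).mul hKm).mul (hΩ''.measurable.comp measurable_snd)
  have hpwb : ∀ p : GaugeConfig 3 L SU2 × GaugeConfig 3 L SU2,
      |Ω'' p.1 * transferKernel su2Rep β p.1 p.2 * Ω'' p.2| ≤ CΩ * Real.exp (2 * β) ^ Fintype.card (Edge 3 L) * CΩ := fun p => by
    rw [abs_mul, abs_mul]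
    exact mul_le_mul (mul_le_mul (hCΩ _) (abs_transferKernel_le_lat hβ0.le p) (abs_nonneg _) hCΩ0) (hCΩ _) (abs_nonneg _)
      (by positivity)
  have hint1 : Integrable (fun p => w p.1 * (Ω'' p.1 * transferKernel su2Rep β p.1 p.2 * Ω'' p.2) * q p) μ2 :=
    integrable_latProd (((hwm.comp measurable_fst).mul hpwm).mul hqm)
      (C := W * (CΩ * Real.exp (2 * β) ^ Fintype.card (Edge 3 L) * CΩ) * 4) fun p => by
      rw [abs_mul, abs_mul, abs_of_nonneg (hq0 p)]
      exact mul_le_mul (mul_le_mul (hwb _) (hpwb p) (abs_nonneg _) hW0.le) (hq4 p) (hq0 p) (by positivity)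
  have hint2 : Integrable (fun p => w p.2 * (Ω'' p.1 * transferKernel su2Rep β p.1 p.2 * Ω'' p.2) * q p) μ2 :=
    integrable_latProd (((hwm.comp measurable_snd).mul hpwm).mul hqm)
      (C := W * (CΩ * Real.exp (2 * β) ^ Fintype.card (Edge 3 L) * CΩ) * 4) fun p => by
      rw [abs_mul, abs_mul, abs_of_nonneg (hq0 p)]
      exact mul_le_mul (mul_le_mul (hwb _) (hpwb p) (abs_nonneg _) hW0.le) (hq4 p) (hq0 p) (by positivity)
  rw [hgoal, integral_add (hint1.const_mul 2) (hint2.const_mul 2), integral_const_mul, integral_const_mul, hswap]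
  have hcore' : ∫ p, w p.1 * (Ω'' p.1 * transferKernel su2Rep β p.1 p.2 * Ω'' p.2) * q p ∂μ2 ≤
      (2 / β) * topValue su2Rep L β * (∫ U, w U * Ω U ^ 2 ∂configMeasure SU2 L) *
        (6 + Real.log W / 2 - Real.log (uniformFloorConst L) + Real.log ((∫ U, w U * Ω U ^ 2 ∂configMeasure SU2 L)⁻¹) / 2) := by
    rw [hμ2, hq_def]; exact hcore
  have hresh : (8 / β) * topValue su2Rep L β * (∫ U, w U * Ω U ^ 2 ∂configMeasure SU2 L) *
        (6 + Real.log W / 2 - Real.log (uniformFloorConst L) + Real.log ((∫ U, w U * Ω U ^ 2 ∂configMeasure SU2 L)⁻¹) / 2) =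
      4 * ((2 / β) * topValue su2Rep L β * (∫ U, w U * Ω U ^ 2 ∂configMeasure SU2 L) *
        (6 + Real.log W / 2 - Real.log (uniformFloorConst L) + Real.log ((∫ U, w U * Ω U ^ 2 ∂configMeasure SU2 L)⁻¹) / 2)) := by
    ring
  rw [hresh]
  linarith

/-! ## §2 The registered stub from an exponentially weak torelon floor -/

/-- ★★★ **`stub_dWeightedPlaquetteMean` ⟸ LOG-FLOOR on the torelon mean.**  If for some `k₀ ≥ 0` and every `ε > 0` there are `C₀, β₁` with,
for all `β ≥ β₁`, every `L` and every `l2`-normalised physical eigenfunction `Ω` at `λ₀`: `0 < E[FΩ²]` and `log(1/E[FΩ²]) ≤ C₀ β^ε L^{k₀}`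
(`F = flowLift 0 (4 − (Re tr P₀)²)`; i.e. `E_Ω[F] ≥ exp(−C₀β^εL^{k₀})`), then the registered stub text `DWeightedPlaquetteMeanP` of the birth
skeleton of ⟨stmt-QuantumFields-23362⟩ holds verbatim (`k = k₀ + 4`, `C = 1088 + 4C₀`, `β₀ = max 1 β₁`).
[cite: ReedSimonIV1978, Thm. XIII.43] [cite: Luscher1983, §2–3] -/
theorem dWeightedPlaquetteMean_of_logFloor
    (hfloor : ∃ k₀ : ℝ, 0 ≤ k₀ ∧ ∀ ε : ℝ, 0 < ε → ∃ C₀ β₁ : ℝ, 0 ≤ C₀ ∧ ∀ β : ℝ, β₁ ≤ β → ∀ (L : ℕ) [NeZero L],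
      ∀ Ω : Literature.MathematicalPhysics.QuantumFieldTheory.GaugeConfig 3 L SU2 → ℝ, IsPhys Ω → l2 Ω Ω = 1 →
        transferApply β Ω = topValue su2Rep L β • Ω →
          0 < l2 (fun U => flowLift 0 (fun u : Literature.MathematicalPhysics.QuantumFieldTheory.GaugeConfig 3 1 SU2 =>
            4 - ((su2Rep (u ((0 : Literature.MathematicalPhysics.QuantumFieldTheory.Site 3 1), (0 : Fin 3)))).trace.re) ^ 2) U * Ω U) Ω ∧
          Real.log (l2 (fun U => flowLift 0 (fun u : Literature.MathematicalPhysics.QuantumFieldTheory.GaugeConfig 3 1 SU2 =>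
            4 - ((su2Rep (u ((0 : Literature.MathematicalPhysics.QuantumFieldTheory.Site 3 1), (0 : Fin 3)))).trace.re) ^ 2) U * Ω U) Ω)⁻¹ ≤
            C₀ * β ^ ε * (L : ℝ) ^ k₀) :
    ∃ k : ℝ, ∀ ε : ℝ, 0 < ε → ∃ C β₀ : ℝ, ∀ β : ℝ, β₀ ≤ β → ∀ (L : ℕ) [NeZero L], ∀ Ω : Literature.MathematicalPhysics.QuantumFieldTheory.GaugeConfig 3 L SU2 → ℝ, IsPhys Ω → l2 Ω Ω = 1 → transferApply β Ω = topValue su2Rep L β • Ω → let F : Literature.MathematicalPhysics.QuantumFieldTheory.GaugeConfig 3 L SU2 → ℝ := flowLift 0 (fun u : Literature.MathematicalPhysics.QuantumFieldTheory.GaugeConfig 3 1 SU2 => 4 - ((su2Rep (u ((0 : Literature.MathematicalPhysics.QuantumFieldTheory.Site 3 1), (0 : Fin 3)))).trace.re) ^ 2); ∀ x : Literature.MathematicalPhysics.QuantumFieldTheory.Site 3 L, ∀ j : ℕ, j < L → ∫ p, Ω p.1 * transferKernel su2Rep β p.1 p.2 * Ω p.2 * ((flowLiftAt x 0 (fun u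 : Literature.MathematicalPhysics.QuantumFieldTheory.GaugeConfig 3 1 SU2 => 4 - ((su2Rep (u ((0 : Literature.MathematicalPhysics.QuantumFieldTheory.Site 3 1), (0 : Fin 3)))).trace.re) ^ 2) p.1 + flowLiftAt x 0 (fun u : Literature.MathematicalPhysics.QuantumFieldTheory.GaugeConfig 3 1 SU2 => 4 - ((su2Rep (u ((0 : Literature.MathematicalPhysics.QuantumFieldTheory.Site 3 1), (0 : Fin 3)))).trace.re) ^ 2) p.2) * (4 - 2 * (((p.1 ((fun z : Literature.MathematicalPhysics.QuantumFieldTheory.Site 3 L => z.shift 0)^[j] x, 0) * (p.2 ((fun z : Literature.MathematicalPhysics.QuantumFieldTheory.Site 3 L => z.shift 0)^[j] x, 0))⁻¹ : SU2) : Matrix (Fin 2) (Fin 2) ℂ).trace.re))) ∂(configMeasure SU2 L).prod (configMeasure SU2 L) ≤ C * β ^ (ε - 1) * (L : ℝ) ^ k * topValue su2Rep L β * l2 (fun U => F U * Ω U) Ω := by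
  obtain ⟨k₀, hk₀, hfl⟩ := hfloor
  refine ⟨k₀ + 4, fun ε hε => ?_⟩
  obtain ⟨C₀, β₁, hC₀, hflε⟩ := hfl ε hε
  refine ⟨1088 + 4 * C₀, max 1 β₁, fun β hβ L _ Ω hΩ hn heig => ?_⟩
  dsimp only
  intro x j _
  haveI : SecondCountableTopology SU2 := secondCountableTopology_su2
  have hβ1 : 1 ≤ β := (le_max_left _ _).trans hβ
  have hββ₁ : β₁ ≤ β := (le_max_right _ _).trans hβ
  have hβ0 : 0 < β := by linarith
  have hL : 1 ≤ L := Nat.one_le_iff_ne_zero.mpr (NeZero.ne L)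
  have hL0 : (0 : ℝ) < L := by exact_mod_cast hL
  have hL1 : (1 : ℝ) ≤ L := by exact_mod_cast hL
  have hT := topValue_su2Rep_pos L β
  set f : GaugeConfig 3 1 SU2 → ℝ := fun u => 4 - ((su2Rep (u ((0 : Site 3 1), (0 : Fin 3)))).trace.re) ^ 2 with hf_def
  set e : Edge 3 L := ((fun z : Site 3 L => z.shift 0)^[j] x, 0) with he_def
  -- the weight `d_x = f_x`: bounded by `4`, physical
  have hfm : Measurable f := by
    have h1 : Continuous fun u : GaugeConfig 3 1 SU2 => su2Rep (u ((0 : Site 3 1), (0 : Fin 3))) :=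
      continuous_su2Rep.comp (continuous_apply _)
    exact (continuous_const.sub ((Complex.continuous_re.comp h1.matrix_trace).pow 2)).measurable
  have hf0 : ∀ u, 0 ≤ f u := fun u => by
    rw [hf_def]; dsimp only
    have h1 := re_trace_le_two (u ((0 : Site 3 1), (0 : Fin 3)))
    have h2 := neg_two_le_re_trace (u ((0 : Site 3 1), (0 : Fin 3)))
    rw [fundamentalRep_apply]; nlinarith
  have hf4 : ∀ u, f u ≤ 4 := fun u => by
    rw [hf_def]; dsimp only; nlinarith [sq_nonneg ((su2Rep (u ((0 : Site 3 1), (0 : Fin 3)))).trace.re)]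
  have hfb : ∀ u, |f u| ≤ 4 := fun u => by rw [abs_of_nonneg (hf0 u)]; exact hf4 u
  have hd0 : ∀ U : GaugeConfig 3 L SU2, 0 ≤ flowLiftAt x 0 f U := fun U => by unfold flowLiftAt; exact hf0 _
  have hd4 : ∀ U : GaugeConfig 3 L SU2, flowLiftAt x 0 f U ≤ 4 := fun U => by unfold flowLiftAt; exact hf4 _
  have hdphys : IsPhys (flowLiftAt (L := L) x 0 f) := isPhys_adjLoopAt x
  have hdm : Measurable (flowLiftAt (L := L) x 0 f) := hdphys.measurable
  have hdΩ : IsPhys fun U => flowLiftAt x 0 f U * Ω U :=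
    hΩ.mul_of_invariant hdm (fun U => by rw [abs_of_nonneg (hd0 U)]; exact hd4 U) hdphys.gaugeInv hdphys.zeroFlux
  -- the torelon mean `m = E[d_xΩ²] = E[FΩ²]`
  set m : ℝ := ∫ U, flowLiftAt x 0 f U * Ω U ^ 2 ∂configMeasure SU2 L with hm_def
  have hmF : l2 (fun U => flowLift 0 f U * Ω U) Ω = m := by
    rw [← l2_flowLiftAt_mul_vacuum_eq_flowLift β hΩ heig hfm hfb x]
    unfold l2; exact integral_congr_ae (ae_of_all _ fun U => by ring)
  obtain ⟨hmpos, hmlog⟩ := hflε β hββ₁ L Ω hΩ hn heig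
  rw [hmF] at hmpos hmlog
  rw [hmF]
  -- the symmetrised weighted bound with `W = 4`
  have hmain := weighted_link_plaquette_symm_le_log hβ1 hΩ hn heig hdΩ hdm hd0 hd4 hmpos e
  have hlog4 : Real.log 4 / 2 ≤ 1 := by
    have : Real.log 4 = 2 * Real.log 2 := by
      rw [show (4 : ℝ) = 2 ^ 2 by norm_num, Real.log_pow]; norm_num
    rw [this]; linarith [Real.log_two_lt_d9]
  have hu := neg_log_uniformFloorConst_le_pow (L := L)
  have hβε : 1 ≤ β ^ ε := Real.one_le_rpow hβ1 hε.le
  have hL4 : (L : ℝ) ^ (4 : ℕ) ≤ (L : ℝ) ^ (k₀ + 4) := by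
    rw [← Real.rpow_natCast]
    exact Real.rpow_le_rpow_of_exponent_le hL1 (by push_cast; linarith)
  have hLk₀ : (L : ℝ) ^ k₀ ≤ (L : ℝ) ^ (k₀ + 4) := Real.rpow_le_rpow_of_exponent_le hL1 (by linarith)
  have hL4' : (1 : ℝ) ≤ (L : ℝ) ^ (4 : ℕ) := one_le_pow₀ hL1
  -- the bracket: `6 + log4/2 − log c_L + ½ log(1/m) ≤ 7 + 129 L⁴ + (C₀/2) β^ε L^{k₀} ≤ (136 + C₀/2) β^ε L^{k₀+4}`
  have hbr : 6 + Real.log 4 / 2 - Real.log (uniformFloorConst L) + Real.log m⁻¹ / 2 ≤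
      (136 + C₀ / 2) * (β ^ ε * (L : ℝ) ^ (k₀ + 4)) := by
    have h1 : 7 + 129 * (L : ℝ) ^ (4 : ℕ) ≤ 136 * (β ^ ε * (L : ℝ) ^ (k₀ + 4)) := by
      have : (L : ℝ) ^ (4 : ℕ) ≤ β ^ ε * (L : ℝ) ^ (k₀ + 4) := by nlinarith
      nlinarith
    have h2 : C₀ * β ^ ε * (L : ℝ) ^ k₀ ≤ C₀ * (β ^ ε * (L : ℝ) ^ (k₀ + 4)) := by
      rw [mul_assoc]; exact mul_le_mul_of_nonneg_left (mul_le_mul_of_nonneg_left hLk₀ (by positivity)) hC₀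
    linarith
  have hβpow : β ^ (ε - 1) = β ^ ε / β := by
    rw [Real.rpow_sub hβ0, Real.rpow_one]
  calc _ ≤ (8 / β) * topValue su2Rep L β * m *
        (6 + Real.log 4 / 2 - Real.log (uniformFloorConst L) + Real.log m⁻¹ / 2) := hmain
    _ ≤ (8 / β) * topValue su2Rep L β * m * ((136 + C₀ / 2) * (β ^ ε * (L : ℝ) ^ (k₀ + 4))) :=
        mul_le_mul_of_nonneg_left hbr (by positivity)
    _ = (1088 + 4 * C₀) * β ^ (ε - 1) * (L : ℝ) ^ (k₀ + 4) * topValue su2Rep L β * m := by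
        rw [hβpow]; field_simp; ring

end Summit.QuantumFields.YangMills.Theorems.TransportFieldFano

end
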